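import Literature.LinearAlgebra.Matrix.CrystallographicRestrictionConverse
import Mathlib.GroupTheory.Perm.Cycle.PossibleTypes
import Mathlib.GroupTheory.Perm.Cycle.Type
import HarnessLib

/-!
# The orders of the elements of the symmetric group `S_n`: Landau's `S(m) = Σ pᵢ^{rᵢ} ≤ n`
# (Bamberg–Cairns–Kilminster 2003, Theorem 2), Theorem 3 (1) ⟺ (3) and Proposition 2

Topic `Literature/GroupTheory/PermutationGroups`, namespace `Literature.GroupTheory.PermutationGroups`; lane
`lit-hodgefound` (Track 2 foundations), self-proposed row g6-#9 of seat `lit-hodgefound-p38` (generation 6),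
completing the formalisation of the held paper [BCK] begun in
`Literature/LinearAlgebra/Matrix/CrystallographicRestriction(Converse).lean` (Theorem 1 `Ord_n = {m | ψ(m) ≤ n}`,
the remark `Ord_{2k+1} = Ord_{2k}`, Proposition 3 (2), Theorem 3 (1) ⟺ (2)).

Source, held `paper:doi-10-2307-3647934` (J. Bamberg, G. Cairns, D. Kilminster, *The crystallographic
restriction, permutations, and Goldbach's conjecture*, Amer. Math. Monthly 110 (2003) 202–209), verbatim:
p0005 L49–L55 "Consider the function `S : ℕ → ℕ` defined as follows: `S(1) = 1` and for `m > 1` with prime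
factorization `m = ∏ᵢ pᵢ^{rᵢ}`, `S(m) = Σᵢ pᵢ^{rᵢ}`. Analogous to Theorem 1, one has [15]: **Theorem 2.** `S_n`
has an element of order `m` if and only if `S(m) ≤ n`."; L57 "Theorem 2 shows that `S⁻¹{n}` is the set of
orders that are realized in `S_n` but are not realized in `S_{n−1}`"; p0006 L7–L10 "**Proposition 2.** If
`m = p₁ ⋯ p_k`, where `p₁, …, p_k` are distinct odd primes, then there exists an `n × n` integer matrix of order
`m` if and only if `S_{n+k}` has an element of order `m`. Proof. In view of Theorems 1 and 2, it suffices to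
notice that `ψ(m) ≤ n` if and only if `(p₁ − 1) + ⋯ + (p_k − 1) ≤ n`, which translates to `S(m) ≤ n + k`.";
p0007 L59–p0008 L10 "**Theorem 3.** The following statements are equivalent: 1. the strong Goldbach conjecture
is true; … 3. for each even `n > 6` there is an element of `S_n` of order `pq` for distinct odd primes `p` and
`q`, and there is no element of `S_{n−1}` of this order. … The equivalence of (1) and (3) follows immediately
from Theorem 2."  ([15] = G. A. Miller's / E. Landau's classical determination of the orders in `S_n`.)

Convention: `landauS` takes the EMPTY-SUM value `S(1) = 0` (and the junk value `S(0) = 0`); [BCK]'s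
`S(1) = 1` differs only at `m = 1` and only matters for `n = 0` (the identity of `S_0` has order `1`), so
Theorem 2 is stated for every `n` and agrees with the printed one for `n ≥ 1`.

Proof followed ("every permutation is a product of disjoint cycles", p0008 L12): the order of a permutation is
the `lcm` of its cycle type (Mathlib `Equiv.Perm.lcm_cycleType`), whose sum is the size of the support
(`sum_cycleType_le`); `S(lcm c) ≤ Σ c` for any multiset of positive integers (`landauS_lcm_le_sum`, from
`S(lcm(a, b)) ≤ S(a) + S(b)` and `S(a) ≤ a`); conversely the disjoint cycles of lengths `p^{v_p(m)}` exist as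
soon as `S(m) ≤ n` (Mathlib `Equiv.Perm.exists_with_cycleType_iff`) and have order `lcm_p p^{v_p(m)} = m`.

## Contents (one definition with body, `landauS`; theorems; NO named fact)

* §1 `landauS` (`S`), `landauS_prime_pow`, `landauS_prime`, **`landauS_mul_of_coprime`**,
  `landauS_mul_of_prime_of_prime` (`S(pq) = p + q`);
* §2 `landauS_le_self` (`S(a) ≤ a`), `landauS_lcm_le` (`S(lcm(a,b)) ≤ S(a) + S(b)`), **`landauS_lcm_le_sum`**,
  `lcm_primeFactors_pow_factorization` (`lcm_p p^{v_p(m)} = m`);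
* §3 `landauS_orderOf_le_card` (`S(ord σ) ≤ |α|`), `exists_perm_orderOf_eq`, **`exists_perm_orderOf_eq_iff`**
  (THEOREM 2 for `Perm α`), **`exists_perm_fin_orderOf_eq_iff`** (THEOREM 2: `S_n` has an element of order `m` iff
  `S(m) ≤ n`), `exists_perm_fin_and_not_iff_landauS_eq` (`S⁻¹{n}` = orders new in `S_n`);
* §4 **`strongGoldbach_iff_forall_exists_perm_orderOf_mul`** (THEOREM 3 (1) ⟺ (3), an `↔` of stated propositions,
  the conjecture is not asserted), `landauS_eq_crPsi_add_card` (`S(m) = ψ(m) + ω(m)` for odd squarefree `m`),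
  **`exists_matrix_orderOf_eq_iff_exists_perm`** (PROPOSITION 2).

NOT here: Proposition 1 (`S_n`-orders are `GL(n−2, ℤ)`-orders for even `n > 2`), Proposition 3 (1) (Richert),
the maximal order `max S⁻¹` (Landau's function `g(n)`).

## References

* [BambergCairnsKilminster2003] J. Bamberg, G. Cairns, D. Kilminster, *The crystallographic restriction,
  permutations, and Goldbach's conjecture*, Amer. Math. Monthly 110 (2003) 202–209, Thm. 2, Thm. 3, Prop. 2.
-/

namespace Literature.GroupTheory.PermutationGroups

open Finset Equiv Equiv.Perm Literature.LinearAlgebra.Matrix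

/-! ### §1 The function `S(m) = Σ_{p^r ‖ m} p^r` -/

/-- **The function `S` of [BCK]**: `S(m) = Σᵢ pᵢ^{rᵢ}` for `m = ∏ᵢ pᵢ^{rᵢ}` — the least degree of a permutation
of order `m`.  (Empty-sum convention `S(1) = 0`; [BCK] put `S(1) = 1`, which changes nothing for `n ≥ 1`.)
[cite: BambergCairnsKilminster2003, §3 (definition of `S`) and Thm. 2] -/
def landauS (m : ℕ) : ℕ := ∑ p ∈ m.primeFactors, p ^ m.factorization p

/-- Unfolding of `landauS`. [cite: BambergCairnsKilminster2003, §3 (definition of `S`)] -/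
theorem landauS_def (m : ℕ) : landauS m = ∑ p ∈ m.primeFactors, p ^ m.factorization p := rfl

/-- `S(0) = 0` (junk value). [cite: BambergCairnsKilminster2003, §3 (definition of `S`)] -/
@[simp] theorem landauS_zero : landauS 0 = 0 := by simp [landauS]

/-- `S(1) = 0` (empty sum). [cite: BambergCairnsKilminster2003, §3 (definition of `S`)] -/
@[simp] theorem landauS_one : landauS 1 = 0 := by simp [landauS]

/-- `S(p^r) = p^r` (`r ≥ 1`). [cite: BambergCairnsKilminster2003, §3 (definition of `S`)] -/
theorem landauS_prime_pow {p r : ℕ} (hp : p.Prime) (hr : r ≠ 0) : landauS (p ^ r) = p ^ r := by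
  rw [landauS, Nat.primeFactors_prime_pow hr hp, Finset.sum_singleton, hp.factorization_pow,
    Finsupp.single_eq_same]

/-- `S(p) = p`. [cite: BambergCairnsKilminster2003, §3 (definition of `S`)] -/
theorem landauS_prime {p : ℕ} (hp : p.Prime) : landauS p = p := by
  simpa using landauS_prime_pow hp one_ne_zero

/-- **`S` is additive over coprime factors.** [cite: BambergCairnsKilminster2003, §3 (definition of `S`)] -/
theorem landauS_mul_of_coprime {m n : ℕ} (h : m.Coprime n) : landauS (m * n) = landauS m + landauS n := by
  rcases eq_or_ne m 0 with rfl | hm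
  · rw [Nat.coprime_zero_left] at h
    subst h
    simp
  rcases eq_or_ne n 0 with rfl | hn
  · rw [Nat.coprime_zero_right] at h
    subst h
    simp
  rw [landauS_def, h.primeFactors_mul, Finset.sum_union h.disjoint_primeFactors, landauS_def, landauS_def]
  congr 1
  · refine Finset.sum_congr rfl fun p hp ↦ ?_
    have hp0 : n.factorization p = 0 :=
      Finsupp.notMem_support_iff.1 (Finset.disjoint_left.1 h.disjoint_primeFactors hp)
    rw [Nat.factorization_mul_apply_of_coprime h, hp0, add_zero]
  · refine Finset.sum_congr rfl fun p hp ↦ ?_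
    have hp0 : m.factorization p = 0 :=
      Finsupp.notMem_support_iff.1 (Finset.disjoint_right.1 h.disjoint_primeFactors hp)
    rw [Nat.factorization_mul_apply_of_coprime h, hp0, zero_add]

/-- `S(pq) = p + q` for distinct primes. [cite: BambergCairnsKilminster2003, Thm. 3, proof ((1) ⟺ (3))] -/
theorem landauS_mul_of_prime_of_prime {p q : ℕ} (hp : p.Prime) (hq : q.Prime) (hpq : p ≠ q) :
    landauS (p * q) = p + q := by
  rw [landauS_mul_of_coprime ((Nat.coprime_primes hp hq).2 hpq), landauS_prime hp, landauS_prime hq]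

/-! ### §2 `S(m) ≤ Σ c` whenever `lcm(c) = m`: the prime powers of an `lcm` sit in the members -/

/-- For a non-empty finset `T` and `f ≥ 2` on `T`: `Σ_T f ≤ ∏_T f`. [folklore] -/
private theorem sum_le_prod_of_two_le' {β : Type*} [DecidableEq β] {T : Finset β} (hT : T.Nonempty)
    {f : β → ℕ} (hf : ∀ a ∈ T, 2 ≤ f a) : ∑ a ∈ T, f a ≤ ∏ a ∈ T, f a := by
  induction hT using Finset.Nonempty.cons_induction with
  | singleton a => simp
  | cons a T ha hT ih =>
    rw [Finset.sum_cons, Finset.prod_cons]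
    have hfa : 2 ≤ f a := hf a (Finset.mem_cons_self a T)
    have hih : ∑ x ∈ T, f x ≤ ∏ x ∈ T, f x := ih fun b hb ↦ hf b (Finset.mem_cons_of_mem hb)
    obtain ⟨b, hb⟩ := hT
    have hP : 2 ≤ ∏ x ∈ T, f x :=
      le_trans (hf b (Finset.mem_cons_of_mem hb))
        (Finset.single_le_prod' (fun c hc ↦ le_trans (by norm_num) (hf c (Finset.mem_cons_of_mem hc))) hb)
    nlinarith

/-- **`S(a) ≤ a`** for `a ≥ 1`: the sum of the prime powers `p^{v_p(a)}` is at most their product `a`.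
[cite: BambergCairnsKilminster2003, Thm. 2 (proof: "every permutation is a product of disjoint cycles")] -/
theorem landauS_le_self {a : ℕ} (ha : a ≠ 0) : landauS a ≤ a := by
  rcases a.primeFactors.eq_empty_or_nonempty with h | h
  · rw [landauS, h, Finset.sum_empty]
    exact Nat.zero_le a
  · calc landauS a ≤ ∏ p ∈ a.primeFactors, p ^ a.factorization p :=
          sum_le_prod_of_two_le' h fun p hp ↦ by
            obtain ⟨hpp, hpd, -⟩ := Nat.mem_primeFactors.1 hp
            exact hpp.two_le.trans (Nat.le_self_pow (hpp.factorization_pos_of_dvd ha hpd).ne' p)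
      _ = a := by
          conv_rhs => rw [← Nat.prod_factorization_pow_eq_self ha]
          rw [Finsupp.prod, Nat.support_factorization]

/-- The prime factors of an `lcm` are those of the two arguments. [folklore] -/
private theorem primeFactors_lcm {a b : ℕ} (ha : a ≠ 0) (hb : b ≠ 0) :
    (a.lcm b).primeFactors = a.primeFactors ∪ b.primeFactors := by
  rw [← Nat.support_factorization, Nat.factorization_lcm ha hb, Finsupp.support_sup, Nat.support_factorization,
    Nat.support_factorization]

/-- **`S(lcm(a, b)) ≤ S(a) + S(b)`**: each prime power `p^{v_p(lcm)}` is `p^{v_p(a)}` or `p^{v_p(b)}`.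
[cite: BambergCairnsKilminster2003, Thm. 2 (proof)] -/
theorem landauS_lcm_le {a b : ℕ} (ha : a ≠ 0) (hb : b ≠ 0) : landauS (a.lcm b) ≤ landauS a + landauS b := by
  rw [landauS_def (a.lcm b), primeFactors_lcm ha hb]
  calc ∑ p ∈ a.primeFactors ∪ b.primeFactors, p ^ (a.lcm b).factorization p
      ≤ ∑ p ∈ a.primeFactors ∪ b.primeFactors,
          ((if p ∈ a.primeFactors then p ^ a.factorization p else 0) +
            (if p ∈ b.primeFactors then p ^ b.factorization p else 0)) := by
        refine Finset.sum_le_sum fun p hp ↦ ?_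
        rw [Nat.factorization_lcm ha hb, Finsupp.sup_apply]
        rcases le_total (b.factorization p) (a.factorization p) with hle | hle
        · rw [sup_eq_left.2 hle]
          have hpa : p ∈ a.primeFactors := by
            rcases Finset.mem_union.1 hp with h | h
            · exact h
            · rw [← Nat.support_factorization, Finsupp.mem_support_iff] at h ⊢
              exact fun h0 ↦ h (Nat.eq_zero_of_le_zero (h0 ▸ hle))
          rw [if_pos hpa]
          exact Nat.le_add_right _ _
        · rw [sup_eq_right.2 hle]
          have hpb : p ∈ b.primeFactors := by
            rcases Finset.mem_union.1 hp with h | h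
            · rw [← Nat.support_factorization, Finsupp.mem_support_iff] at h ⊢
              exact fun h0 ↦ h (Nat.eq_zero_of_le_zero (h0 ▸ hle))
            · exact h
          rw [if_pos hpb]
          exact Nat.le_add_left _ _
    _ = landauS a + landauS b := by
        rw [Finset.sum_add_distrib, Finset.sum_ite_mem, Finset.sum_ite_mem, Finset.union_inter_cancel_left,
          Finset.union_inter_cancel_right, landauS_def, landauS_def]

/-- **`S(lcm c) ≤ Σ c`** for a finite multiset `c` of positive integers (induction on `c`).
[cite: BambergCairnsKilminster2003, Thm. 2 (proof: disjoint cycles)] -/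
theorem landauS_lcm_le_sum (c : Multiset ℕ) (hc : (0 : ℕ) ∉ c) : landauS c.lcm ≤ c.sum := by
  induction c using Multiset.induction_on with
  | empty => simp
  | cons a c ih =>
    rw [Multiset.mem_cons, not_or] at hc
    have ha : a ≠ 0 := fun h ↦ hc.1 h.symm
    have hL : c.lcm ≠ 0 := fun h ↦ hc.2 ((Multiset.lcm_eq_zero_iff c).1 h)
    rw [Multiset.lcm_cons, Multiset.sum_cons]
    exact (landauS_lcm_le ha hL).trans (Nat.add_le_add (landauS_le_self ha) (ih hc.2))

/-- **`lcm_{p ∣ m} p^{v_p(m)} = m`** (`m ≥ 1`): the disjoint cycles of lengths `p^{v_p(m)}` have order `m`.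
[cite: BambergCairnsKilminster2003, Thm. 2 (sufficiency: disjoint cycles of prime-power lengths)] -/
theorem lcm_primeFactors_pow_factorization {m : ℕ} (hm : m ≠ 0) :
    m.primeFactors.lcm (fun p ↦ p ^ m.factorization p) = m := by
  refine Nat.dvd_antisymm (Finset.lcm_dvd fun p _ ↦ Nat.ordProj_dvd m p) ?_
  refine (Nat.dvd_iff_prime_pow_dvd_dvd _ m).2 fun p i hp hpi ↦ ?_
  rcases Nat.eq_zero_or_pos i with rfl | hi
  · simp
  have hpm : p ∈ m.primeFactors := Nat.mem_primeFactors.2 ⟨hp, (dvd_pow_self p hi.ne').trans hpi, hm⟩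
  exact (pow_dvd_pow p ((hp.pow_dvd_iff_le_factorization hm).1 hpi)).trans
    (Finset.dvd_lcm (f := fun p ↦ p ^ m.factorization p) hpm)

/-! ### §3 Theorem 2: `S_n` has an element of order `m` iff `S(m) ≤ n` -/

section Perm

variable {α : Type*} [Fintype α] [DecidableEq α]

/-- **The order of a permutation costs `S(ord σ)` points: `S(ord σ) ≤ #support σ ≤ |α|`** (`ord σ` is the
`lcm` of the cycle type, whose sum is `#support σ`). [cite: BambergCairnsKilminster2003, Thm. 2 (necessity)] -/
theorem landauS_orderOf_le_card (σ : Perm α) : landauS (orderOf σ) ≤ Fintype.card α := by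
  rw [← lcm_cycleType]
  refine (landauS_lcm_le_sum σ.cycleType fun h ↦ ?_).trans σ.sum_cycleType_le
  exact absurd (two_le_of_mem_cycleType h) (by norm_num)

/-- **A permutation of order `m` on `|α| ≥ S(m)` points**: the product of disjoint cycles of lengths
`p^{v_p(m)}`, `p ∣ m`. [cite: BambergCairnsKilminster2003, Thm. 2 (sufficiency)] -/
theorem exists_perm_orderOf_eq {m : ℕ} (hm : 0 < m) (h : landauS m ≤ Fintype.card α) :
    ∃ σ : Perm α, orderOf σ = m := by
  have h2 : ∀ a ∈ (m.primeFactors.val.map fun p ↦ p ^ m.factorization p), 2 ≤ a := fun a ha ↦ by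
    obtain ⟨p, hp, rfl⟩ := Multiset.mem_map.1 ha
    obtain ⟨hpp, hpd, -⟩ := Nat.mem_primeFactors.1 (Finset.mem_def.2 hp)
    exact hpp.two_le.trans (Nat.le_self_pow (hpp.factorization_pos_of_dvd hm.ne' hpd).ne' p)
  have hsum : (m.primeFactors.val.map fun p ↦ p ^ m.factorization p).sum ≤ Fintype.card α := h
  obtain ⟨g, hg⟩ := (Equiv.Perm.exists_with_cycleType_iff (α := α)
    (m := m.primeFactors.val.map fun p ↦ p ^ m.factorization p)).2 ⟨hsum, h2⟩
  refine ⟨g, ?_⟩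
  have hl : (m.primeFactors.val.map fun p ↦ p ^ m.factorization p).lcm = m :=
    lcm_primeFactors_pow_factorization hm.ne'
  rw [← lcm_cycleType, hg, hl]

/-- **Theorem 2 (Landau): there is a permutation of `α` of order `m` iff `S(m) ≤ |α|`** (`m ≥ 1`).
[cite: BambergCairnsKilminster2003, Thm. 2] -/
theorem exists_perm_orderOf_eq_iff {m : ℕ} (hm : 0 < m) :
    (∃ σ : Perm α, orderOf σ = m) ↔ landauS m ≤ Fintype.card α :=
  ⟨fun ⟨σ, hσ⟩ ↦ hσ ▸ landauS_orderOf_le_card σ, exists_perm_orderOf_eq hm⟩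

end Perm

/-- **Theorem 2 of Bamberg–Cairns–Kilminster: "`S_n` has an element of order `m` if and only if `S(m) ≤ n`."**
[cite: BambergCairnsKilminster2003, Thm. 2] -/
theorem exists_perm_fin_orderOf_eq_iff {m n : ℕ} (hm : 0 < m) :
    (∃ σ : Perm (Fin n), orderOf σ = m) ↔ landauS m ≤ n := by
  rw [exists_perm_orderOf_eq_iff hm, Fintype.card_fin]

/-- **`S⁻¹{n}` is the set of orders realized in `S_n` but not in `S_{n−1}`** (elementwise, `m, n ≥ 1`).
[cite: BambergCairnsKilminster2003, §3 (after Thm. 2)] -/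
theorem exists_perm_fin_and_not_iff_landauS_eq {m n : ℕ} (hm : 0 < m) (hn : 0 < n) :
    ((∃ σ : Perm (Fin n), orderOf σ = m) ∧ ¬∃ σ : Perm (Fin (n - 1)), orderOf σ = m) ↔ landauS m = n := by
  rw [exists_perm_fin_orderOf_eq_iff hm, exists_perm_fin_orderOf_eq_iff hm]
  omega

/-! ### §4 Theorem 3 (1) ⟺ (3), and Proposition 2 -/

/-- **Theorem 3, (1) ⟺ (3): the strong Goldbach conjecture holds iff "for each even `n > 6` there is an
element of `S_n` of order `pq` for distinct odd primes `p` and `q`, and there is no element of `S_{n−1}` of this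
order"** (`S(pq) = p + q`; both sides are stated propositions, neither is asserted).
[cite: BambergCairnsKilminster2003, Thm. 3 (1) ⟺ (3)] -/
theorem strongGoldbach_iff_forall_exists_perm_orderOf_mul :
    (∀ x : ℕ, Even x → 6 < x → ∃ p q : ℕ, p.Prime ∧ q.Prime ∧ p ≠ q ∧ p ≠ 2 ∧ q ≠ 2 ∧ x = p + q) ↔
      ∀ n : ℕ, Even n → 6 < n → ∃ p q : ℕ, p.Prime ∧ q.Prime ∧ p ≠ q ∧ p ≠ 2 ∧ q ≠ 2 ∧
        (∃ σ : Perm (Fin n), orderOf σ = p * q) ∧ ¬∃ σ : Perm (Fin (n - 1)), orderOf σ = p * q := by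
  refine forall_congr' fun n ↦ forall_congr' fun hn ↦ forall_congr' fun h6 ↦ ?_
  refine exists_congr fun p ↦ exists_congr fun q ↦ ?_
  refine and_congr_right fun hp ↦ and_congr_right fun hq ↦ and_congr_right fun hpq ↦
    and_congr_right fun _ ↦ and_congr_right fun _ ↦ ?_
  rw [exists_perm_fin_and_not_iff_landauS_eq (Nat.mul_pos hp.pos hq.pos) (by omega),
    landauS_mul_of_prime_of_prime hp hq hpq, eq_comm]

/-- For an odd squarefree `m`, `S(m) = ψ(m) + ω(m)` (`ω(m)` the number of prime factors: each summand is
`p = (p − 1) + 1`). [cite: BambergCairnsKilminster2003, Prop. 2 (proof)] -/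
theorem landauS_eq_crPsi_add_card {m : ℕ} (hodd : Odd m) (hsq : Squarefree m) :
    landauS m = crPsi m + m.primeFactors.card := by
  have hm0 : m ≠ 0 := hsq.ne_zero
  have hv : ∀ p ∈ m.primeFactors, m.factorization p = 1 := fun p hp ↦ by
    obtain ⟨hpp, hpd, -⟩ := Nat.mem_primeFactors.1 hp
    have h1 := Nat.squarefree_iff_factorization_le_one hm0 |>.1 hsq p
    have h2 := hpp.factorization_pos_of_dvd hm0 hpd
    omega
  have hp2 : ∀ p ∈ m.primeFactors, p ≠ 2 := fun p hp h ↦ by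
    subst h
    exact (Nat.not_even_iff_odd.2 hodd) (even_iff_two_dvd.2 (Nat.mem_primeFactors.1 hp).2.1)
  rw [landauS_def, crPsi_def, Finset.card_eq_sum_ones, ← Finset.sum_add_distrib]
  refine Finset.sum_congr rfl fun p hp ↦ ?_
  have hpp := Nat.prime_of_mem_primeFactors hp
  rw [hv p hp, pow_one, if_neg (hp2 p hp), Nat.totient_prime hpp]
  have := hpp.two_le
  omega

/-- **Proposition 2 of Bamberg–Cairns–Kilminster: "If `m = p₁ ⋯ p_k`, where `p₁, …, p_k` are distinct odd
primes, then there exists an `n × n` integer matrix of order `m` if and only if `S_{n+k}` has an element of order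
`m`"** (`n ≥ 1`; `ψ(m) ≤ n ⟺ S(m) ≤ n + k`). [cite: BambergCairnsKilminster2003, Prop. 2] -/
theorem exists_matrix_orderOf_eq_iff_exists_perm {m n : ℕ} (hodd : Odd m) (hsq : Squarefree m) (hn : 0 < n) :
    (∃ A : Matrix (Fin n) (Fin n) ℤ, orderOf A = m) ↔
      ∃ σ : Perm (Fin (n + m.primeFactors.card)), orderOf σ = m := by
  have hm : 0 < m := hodd.pos
  rw [exists_perm_fin_orderOf_eq_iff hm, landauS_eq_crPsi_add_card hodd hsq]
  have h1 : (∃ A : Matrix (Fin n) (Fin n) ℤ, orderOf A = m) ↔ crPsi m ≤ n := by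
    have h := Set.ext_iff.1 (setOf_orderOf_eq_setOf_crPsi_le hn) m
    simp only [Set.mem_setOf_eq] at h
    exact ⟨fun hA ↦ (h.1 ⟨hm, hA⟩).2, fun hψ ↦ (h.2 ⟨hm, hψ⟩).2⟩
  rw [h1]
  omega

end Literature.GroupTheory.PermutationGroups
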